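import Mathlib
import Literature.MathematicalPhysics.QuantumFieldTheory.Balaban1983to89.B12PolarizationHolo
import Literature.MathematicalPhysics.QuantumFieldTheory.Balaban1983to89.B12Decay510Torus

/-!
# `Balaban1983to89.B12PolarizationHoloTorus` — [Balaban1987RG1] (1.20)–(1.21) in holomorphic currency ON THE PERIODIC CARRIER OF
# PRINT: every geometric leaf of `B12PolarizationHolo.exists_holo_kernel` discharged on the exhausting family of tori

T. Bałaban, *Renormalization group approach to lattice gauge field theories. I*, Commun. Math. Phys. **109** (1987) 249–301
[Balaban1987RG1] («[I]»; PDF page = journal page − 248).  TRACK A, DAG node N09 = `Dag.B12_main`, seat `pub-ymgap-dag-n09-a` (g2).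
Composition, NOTHING quoted afresh: the analytic layer is `…B12PolarizationHolo` (§1 holomorphy in the coupling of the (4.3) form from joint
analyticity; §2 (4.37) at complex couplings; §3 the limit (1.21) by Vitali; §4 assembly over abstract `SiteGeometry` leaves), the
geometric layer is `…B12Decay510Torus` (p. 251 torus, p. 257 cubes of side M and d_j, the leaves `geomLeafT` ∕ `cubeSumLeafT` ∕
`treeLeafT` PROVED on the periodic cube system `TreeLengthTorus.tcubeSys`, the window isometry `pl1_proj_zero_sub_proj_eventually`);
the printed wordings are those certified in the headers of these two modules and of `…B12Decay510`.

WHAT THIS MODULE PROVES (0 sorry; axioms {propext, Classical.choice, Quot.sound}).  On an exhausting family of tori `T₁` with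
`N_n·M` sites per direction (`N_n → ∞`; cubes of side `M ≥ 1`; localization domains = torus-face-connected unions of cubes; `d_j :=
torusTreeLen`), GIVEN ONLY the analytic inputs — the terms `(g, 𝐀) ↦ 𝐄ₙ(X̄, g, 𝐀)` jointly analytic on `U ×` (4.4) (`U ⊆ ℂ` connected
open ⊇ `[0, γ]`, `γ > 0`) with (1.18) there uniformly in `g ∈ U` (p. 266 «analytic functions of the effective coupling constants»),
the minimizer responses bounded by `B₃e^{−δ₀dist(x, X̄)}` (p. 282), `δ₀ > 0`, `κ ≥ 2κ₀(4·2ᵈ, 2d)`, `κ > 0` — and the convergence of the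
complex finite-volume kernels `Π_{T_n}(t; 0, z mod N_nM)` at every REAL coupling `t ∈ [0, γ]` to the printed limit `Pℓ t z` ((1.21) «This
limit exists»):
* `exists_holo_kernel_torus` — a kernel `Pc(g, z)` HOLOMORPHIC in `g ∈ U`, obeying (5.10) ON `U` with the SAME constants as
  `B12Decay510Torus.decay510_torus` (`C = 4E₀α₂⁻²B₃² e^{3Mdδ₁} K₀(4·2ᵈ, 2d) K₁(d, δ₀∕2)`, `δ₁ = ½ min{δ₀, κ(Md)⁻¹}`), equal to `Pℓ` at real
  couplings, and the limit of the finite-volume kernels at EVERY `g ∈ U`;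
* `nonempty_piHoloSource_torus` — for a tower whose `β_{k+1}` is (5.42) of a real kernel family whose `(μ, ν)`-component is `Re Pℓ` on
  `[0, γ]` and whose `β′` dominates `betaPrime510 d C δ₁`: `Nonempty (B12BetaHolo.PiHoloSource T c k)`;
* `betaClauses_torus` — hence `BetaSmoothAt T c k` (the UNSOURCED p. 264 clause) ∧ `BetaAnalyticAt T c k` ∧ `|β_{k+1}| ≤ β′` on `[0, γ]` ∧
  `∃ β′ₙ, BetaDerivBoundsAt T c k β′ₙ`.
EVERY GEOMETRIC HYPOTHESIS IS GONE; what remains is exactly: joint analyticity with (1.18) on the complex coupling neighbourhood, the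
p. 282 response decay, the real-coupling limit (1.21), and the identification of the record's real kernel with `Re Pℓ`.

HONEST FRAMING.  Count-neutral Literature theorems; the Stage-5∕8 objects of record (`Node00/BetaOfRecord`: `polLimit`, `PolLimitExists`,
`betaOfTerms`) are what will instantiate the analytic inputs; nothing of N09's statement of record is discharged here.  Analytic READING of the
p. 264 β-clause only; the SIGN of β (NODE O) untouched.  One finite four-torus programme at fixed ε; NOT ℝ⁴, NOT infinite volume, NOT OS axioms,
NOT a mass gap, NOT the Clay problem.
-/

noncomputable section

open Set Filter Metric Topology Complex

namespace Literature.MathematicalPhysics.QuantumFieldTheory.Balaban1983to89.B12PolarizationHoloTorus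

open Literature.MathematicalPhysics.QuantumFieldTheory.Balaban1983to89
open Literature.MathematicalPhysics.QuantumFieldTheory.Balaban1983to89.Step
open Literature.MathematicalPhysics.QuantumFieldTheory.Balaban1983to89.B12StepObligation
open Literature.MathematicalPhysics.QuantumFieldTheory.Balaban1983to89.B12BetaSmooth
open Literature.MathematicalPhysics.QuantumFieldTheory.Balaban1983to89.B12BetaHolo
open Literature.MathematicalPhysics.QuantumFieldTheory.Balaban1983to89.B12PolarizationHolo
open Literature.MathematicalPhysics.QuantumFieldTheory.Balaban1983to89.B13ScaleTransfer (Pt)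
open Literature.MathematicalPhysics.QuantumFieldTheory.Balaban1983to89.TreeLengthTorus
open Literature.MathematicalPhysics.QuantumFieldTheory.Balaban1983to89.B12TreeDecay
open Literature.MathematicalPhysics.QuantumFieldTheory.Balaban1983to89.B12Decay510
open Literature.MathematicalPhysics.QuantumFieldTheory.Balaban1983to89.B12Decay510Window
open Literature.MathematicalPhysics.QuantumFieldTheory.Balaban1983to89.B12Decay510Torus

variable {d : ℕ} {M : ℕ} [NeZero M] {U : Set ℂ}

/-- **(1.20)–(1.21) IN HOLOMORPHIC CURRENCY ON THE TORI OF PRINT, every geometric leaf discharged.**  An exhausting family of tori `T₁`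
(`N_n·M` sites per direction, `N_n → ∞`); on each, terms jointly analytic in `(g, 𝐀)` on `U ×` (4.4) with (1.18) uniformly in `g ∈ U`
(`U` connected open ⊇ `[0, γ]`, `γ > 0`), responses with the p. 282 decay in the periodic distance from the site to the domain, `δ₀ > 0`,
`κ ≥ 2κ₀(4·2ᵈ, 2d)`, and convergence of the complex kernels at the sites `0`, `z mod N_nM` for every REAL coupling in `[0, γ]` to `Pℓ t z`
⇒ a kernel `Pc` HOLOMORPHIC in `g ∈ U` with (5.10) on `U` (the constants of `B12Decay510Torus.decay510_torus`), `= Pℓ` at real couplings,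
and the limit of the finite-volume kernels at every `g ∈ U`. [cite: Balaban1987RG1, (1.20)–(1.21) p.264 with p.266, (5.1) p.292, (5.10) p.293] -/
theorem exists_holo_kernel_torus (hd : 0 < d) (N : ℕ → ℕ) [∀ n, NeZero (N n)] (hN : Tendsto N atTop atTop)
    (hU : IsOpen U) (hUc : IsPreconnected U) {γ : ℝ} (hγ : 0 < γ) (hIU : ∀ t ∈ Icc (0 : ℝ) γ, (t : ℂ) ∈ U)
    (Wn : ℕ → Type*) [∀ n, NormedAddCommGroup (Wn n)] [∀ n, NormedSpace ℂ (Wn n)]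
    (EXn : (n : ℕ) → ℂ → TDom d (N n) → Wn n → ℂ) (hn : (n : ℕ) → TDom d (N n) → TPt d (N n * M) → Wn n)
    (Pℓ : ℝ → Pt d → ℂ) {α₂ E₀ B₃ κ δ₀ : ℝ} (hα₂ : 0 < α₂) (hE₀ : 0 ≤ E₀) (hB₃ : 0 ≤ B₃) (hδ₀ : 0 < δ₀)
    (hκ : kappa₀ (4 * 2 ^ d) (2 * d) ≤ κ / 2)
    (han : ∀ n X, AnalyticOnNhd ℂ (fun p : ℂ × Wn n => EXn n p.1 X p.2) (U ×ˢ ball 0 α₂))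
    (h118 : ∀ n, ∀ g ∈ U, ∀ X, ∀ v ∈ ball (0 : Wn n) α₂, ‖EXn n g X v‖ ≤ E₀ * Real.exp (-κ * torusTreeLen X.1))
    (hh : ∀ n X x, ‖hn n X x‖ ≤ B₃ * Real.exp (-δ₀ * distCT (N n) M x (nearT (M := M) x X)))
    (hlim : ∀ z, ∀ t ∈ Icc (0 : ℝ) γ,
      Tendsto (fun n => piT (S := tsys d (N n)) (EXn n) (hn n) t (proj (N n * M) 0) (proj (N n * M) z)) atTop (𝓝 (Pℓ t z))) :
    ∃ Pc : ℂ → Pt d → ℂ, (∀ z, DifferentiableOn ℂ (fun g => Pc g z) U) ∧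
      (∀ z, ∀ g ∈ U, ‖Pc g z‖ ≤ 4 * E₀ / α₂ ^ 2 * B₃ ^ 2 *
        Real.exp (delta1 δ₀ κ ((M : ℝ) * d) * ((M : ℝ) * d) * 3) * K₀ (4 * 2 ^ d) (2 * d) * K₁ d (δ₀ / 2) *
        Real.exp (-(delta1 δ₀ κ ((M : ℝ) * d)) * B12Sec2to5.l1 z)) ∧
      (∀ z, ∀ t ∈ Icc (0 : ℝ) γ, Pc t z = Pℓ t z) ∧
      (∀ z, ∀ g ∈ U, Tendsto (fun n => piT (S := tsys d (N n)) (EXn n) (hn n) g (proj (N n * M) 0) (proj (N n * M) z)) atTop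
        (𝓝 (Pc g z))) := by
  have hκ0 : 0 ≤ κ := by
    have := kappa₀_nonneg (c₀ := 4 * 2 ^ d) (by positivity) (2 * d)
    linarith
  have hMd : (0 : ℝ) < (M : ℝ) * d := mul_pos (Nat.cast_pos.2 (Nat.pos_of_neZero M)) (Nat.cast_pos.2 hd)
  exact exists_holo_kernel hU hUc hγ hIU (fun n => tsys d (N n)) (fun n => (tcubeSys d (N n)).toCubeCover)
    (fun n => TPt d (N n * M)) (fun n => geomT d (N n) M) (fun _ x y => pl1 (x - y)) Wn EXn hn
    (fun n z => proj (N n * M) z) Pℓ hα₂ hE₀ hB₃ (K₀_pos _ _).le hδ₀.le hκ0 hMd han h118 hh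
    (fun n => geomLeafT d (N n) M) (fun n => cubeSumLeafT d (N n) M (half_pos hδ₀)) (fun n => treeLeafT d (N n) hκ)
    (pl1_proj_zero_sub_proj_eventually N hN) hlim

variable {P : Params} {G : Type*} [GaugeGroup G] {Φ 𝒢 : Type*}

/-- **A holomorphic Π-source FROM THE ANALYTIC INPUTS ALONE, on the tori of print**: under the hypotheses of `exists_holo_kernel_torus` with
`U ⊇ [0, c.γ]`, `κ > 0`, a tower whose `β_{k+1}` is (5.42) of a real kernel family `Pk` whose `(μ, ν)`-component is `Re Pℓ` on `[0, c.γ]`, and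
`β′ ≥ betaPrime510 d C δ₁` for the torus constants: `Nonempty (B12BetaHolo.PiHoloSource T c k)`.
[cite: Balaban1987RG1, (1.20)–(1.22) p.264, p.266 (analytic alternative), (5.10) p.293, (5.42) p.297] -/
theorem nonempty_piHoloSource_torus {T : SFTower P G Φ 𝒢} {c : SFConsts} {k : ℕ} (hd : 0 < d) (N : ℕ → ℕ)
    [∀ n, NeZero (N n)] (hN : Tendsto N atTop atTop) (hU : IsOpen U) (hUc : IsPreconnected U) (hγ : 0 < c.γ)
    (hIU : ∀ t ∈ Icc (0 : ℝ) c.γ, (t : ℂ) ∈ U)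
    (Wn : ℕ → Type*) [∀ n, NormedAddCommGroup (Wn n)] [∀ n, NormedSpace ℂ (Wn n)]
    (EXn : (n : ℕ) → ℂ → TDom d (N n) → Wn n → ℂ) (hn : (n : ℕ) → TDom d (N n) → TPt d (N n * M) → Wn n)
    (Pℓ : ℝ → Pt d → ℂ) (μ ν : Fin d) (Pk : ℝ → B12Beta.Kernel d)
    (beta_eq : ∀ g, 0 ≤ g → g ≤ c.γ → T.flow.β (k + 1) g = B12Beta.secondMoment (Pk g) μ ν)
    (hPk : ∀ z, ∀ t ∈ Icc (0 : ℝ) c.γ, Pk t μ ν z = (Pℓ t z).re)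
    {α₂ E₀ B₃ κ δ₀ : ℝ} (hα₂ : 0 < α₂) (hE₀ : 0 ≤ E₀) (hB₃ : 0 ≤ B₃) (hδ₀ : 0 < δ₀) (hκpos : 0 < κ)
    (hκ : kappa₀ (4 * 2 ^ d) (2 * d) ≤ κ / 2)
    (le_beta' : B12Sec2to5.betaPrime510 d (4 * E₀ / α₂ ^ 2 * B₃ ^ 2 *
        Real.exp (delta1 δ₀ κ ((M : ℝ) * d) * ((M : ℝ) * d) * 3) * K₀ (4 * 2 ^ d) (2 * d) * K₁ d (δ₀ / 2))
      (delta1 δ₀ κ ((M : ℝ) * d)) ≤ c.β')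
    (han : ∀ n X, AnalyticOnNhd ℂ (fun p : ℂ × Wn n => EXn n p.1 X p.2) (U ×ˢ ball 0 α₂))
    (h118 : ∀ n, ∀ g ∈ U, ∀ X, ∀ v ∈ ball (0 : Wn n) α₂, ‖EXn n g X v‖ ≤ E₀ * Real.exp (-κ * torusTreeLen X.1))
    (hh : ∀ n X x, ‖hn n X x‖ ≤ B₃ * Real.exp (-δ₀ * distCT (N n) M x (nearT (M := M) x X)))
    (hlim : ∀ z, ∀ t ∈ Icc (0 : ℝ) c.γ,
      Tendsto (fun n => piT (S := tsys d (N n)) (EXn n) (hn n) t (proj (N n * M) 0) (proj (N n * M) z)) atTop (𝓝 (Pℓ t z))) :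
    Nonempty (PiHoloSource T c k) := by
  have hMd : (0 : ℝ) < (M : ℝ) * d := mul_pos (Nat.cast_pos.2 (Nat.pos_of_neZero M)) (Nat.cast_pos.2 hd)
  obtain ⟨Pc, hPc, hbd, hreal, -⟩ := exists_holo_kernel_torus hd N hN hU hUc hγ hIU Wn EXn hn Pℓ hα₂ hE₀ hB₃ hδ₀ hκ
    han h118 hh hlim
  exact nonempty_piHoloSource μ ν Pk beta_eq hU hIU Pc hPc (delta1_pos hδ₀ hκpos hMd) hbd
    (fun z t ht => by rw [hPk z t ht, hreal z t ht]) le_beta'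

/-- **Every β-clause of the Theorem-3 step FROM THE ANALYTIC INPUTS ALONE, on the tori of print** (`nonempty_piHoloSource_torus` +
`B12BetaHolo.betaClauses_of_piHolo`): `BetaSmoothAt` (the unsourced p. 264 clause), `BetaAnalyticAt`, `|β_{k+1}| ≤ β′`, all-derivative bounds.
[cite: Balaban1987RG1, p.264 (β-clause) with p.266 (analytic alternative)] -/
theorem betaClauses_torus {T : SFTower P G Φ 𝒢} {c : SFConsts} {k : ℕ} (hd : 0 < d) (N : ℕ → ℕ)
    [∀ n, NeZero (N n)] (hN : Tendsto N atTop atTop) (hU : IsOpen U) (hUc : IsPreconnected U) (hγ : 0 < c.γ)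
    (hIU : ∀ t ∈ Icc (0 : ℝ) c.γ, (t : ℂ) ∈ U)
    (Wn : ℕ → Type*) [∀ n, NormedAddCommGroup (Wn n)] [∀ n, NormedSpace ℂ (Wn n)]
    (EXn : (n : ℕ) → ℂ → TDom d (N n) → Wn n → ℂ) (hn : (n : ℕ) → TDom d (N n) → TPt d (N n * M) → Wn n)
    (Pℓ : ℝ → Pt d → ℂ) (μ ν : Fin d) (Pk : ℝ → B12Beta.Kernel d)
    (beta_eq : ∀ g, 0 ≤ g → g ≤ c.γ → T.flow.β (k + 1) g = B12Beta.secondMoment (Pk g) μ ν)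
    (hPk : ∀ z, ∀ t ∈ Icc (0 : ℝ) c.γ, Pk t μ ν z = (Pℓ t z).re)
    {α₂ E₀ B₃ κ δ₀ : ℝ} (hα₂ : 0 < α₂) (hE₀ : 0 ≤ E₀) (hB₃ : 0 ≤ B₃) (hδ₀ : 0 < δ₀) (hκpos : 0 < κ)
    (hκ : kappa₀ (4 * 2 ^ d) (2 * d) ≤ κ / 2)
    (le_beta' : B12Sec2to5.betaPrime510 d (4 * E₀ / α₂ ^ 2 * B₃ ^ 2 *
        Real.exp (delta1 δ₀ κ ((M : ℝ) * d) * ((M : ℝ) * d) * 3) * K₀ (4 * 2 ^ d) (2 * d) * K₁ d (δ₀ / 2))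
      (delta1 δ₀ κ ((M : ℝ) * d)) ≤ c.β')
    (han : ∀ n X, AnalyticOnNhd ℂ (fun p : ℂ × Wn n => EXn n p.1 X p.2) (U ×ˢ ball 0 α₂))
    (h118 : ∀ n, ∀ g ∈ U, ∀ X, ∀ v ∈ ball (0 : Wn n) α₂, ‖EXn n g X v‖ ≤ E₀ * Real.exp (-κ * torusTreeLen X.1))
    (hh : ∀ n X x, ‖hn n X x‖ ≤ B₃ * Real.exp (-δ₀ * distCT (N n) M x (nearT (M := M) x X)))
    (hlim : ∀ z, ∀ t ∈ Icc (0 : ℝ) c.γ,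
      Tendsto (fun n => piT (S := tsys d (N n)) (EXn n) (hn n) t (proj (N n * M) 0) (proj (N n * M) z)) atTop (𝓝 (Pℓ t z))) :
    BetaSmoothAt T c k ∧ BetaAnalyticAt T c k ∧ (∀ x ∈ Set.Icc (0 : ℝ) c.γ, |T.flow.β (k + 1) x| ≤ c.β') ∧
      ∃ β'n : ℕ → ℝ, BetaDerivBoundsAt T c k β'n := by
  obtain ⟨S⟩ := nonempty_piHoloSource_torus hd N hN hU hUc hγ hIU Wn EXn hn Pℓ μ ν Pk beta_eq hPk hα₂ hE₀ hB₃ hδ₀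
    hκpos hκ le_beta' han h118 hh hlim
  obtain ⟨h1, h2, h3, h4⟩ := betaClauses_of_piHolo hγ S
  exact ⟨h1, h2, h3, _, h4⟩

end Literature.MathematicalPhysics.QuantumFieldTheory.Balaban1983to89.B12PolarizationHoloTorus

end
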